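import Summits.ABC.IUTFork.Repair.RHSigmaSignedRemainder
import Summits.ABC.IUTFork.Repair.RHHeightScaling
import Summits.ABC.IUTFork.Repair.RHLabelWeightSchemes
import Summits.ABC.IUTFork.Repair.RHReqsideLabelsNoSymmetry
import Summits.ABC.IUTFork.Repair.RHReqsideLabelsPlusMinusOrbits
import Mathlib.GroupTheory.GroupAction.Quotient
import HarnessLib

/-!
# R-H ROUND 4, row R4-7 «REQUIREMENT-SIDE DROP-ONE SHEETS», item (b) TYPING LANE (KEY «R4CON-TYPE»), part B: V3 (LICENSING / the HONEST CONE)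
# and V4 (LABEL SYMMETRY / the uniform `1/l⋆`) — what a theory WITHOUT the constraint must SUPPLY, as claim-tagged `Prop`s in OUR typed currency

abc-iut cell, rung LADDER-ABC:A2.RESCUE.H; seat abc-iut-L5-t8 (GEN 10; KEY `wake/KEY-abc-iut-L5-t8-R4CON-TYPE.md` c222993d1b59221e, abc-iut-rh-lead g5 (OPENINGS-CENSUS pen)
2026-08-27T13:59Z under director-abc g6-D5/D7 and HUMAN D-0133 · D-0134 · D-0135; task = `ROUND4/R4-TASKS.md` row R4CON-TYPE). Companion of PART A
`Repair/RHRound4ConstraintRequirements.lean` (§0 the T-LP's rows as named predicates, V1 box, V2 netting) — independent of it (no import; 400-line rule, D-0064). For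
each R4-7 drop-one sheet this lane types item (b) «what a theory WITHOUT this constraint must supply instead, as claim-tagged `def … : Prop` signatures» over the typed
cell currency, citing landed decls BY NAME: the honest-cone currency p479556/p477034/p480491 (`licenceCells`, `cellDeficit`, `cellTrivialCost`, `BridgeHyps`), the
integer cell `DiffPricedHull.HullCellδ` / `HeightScaling.price`·`demand` (p532994), the label-weight FENCE `RHLabelWeightSchemes` (p488865) and the label-symmetry faces
`RHReqsideLabels*` (p513512 / p529636 / p529840 / p505937), and — for V4's `ν`-Corollary — the pattern of abc-iut-reqb-typ-1's K2 `TruncStatement` (p536101).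
HONEST FRAMING / GUARDS: every `def … : Prop` / structure here is a HYPOTHESIS-SHAPED REQUIREMENT or OUR bookkeeping object — what a hypothetical theory dropping the
row would have to certify or construct — not a reading of [IUTchI–IV], not a claim that such objects exist, NEVER a Literature fact (FROZEN FACT-LIST
f75a60bac22efdb6; 0 new Literature Props; no `instance` / `notation` / `macro`; placeholder notions of the sheets enter as PARAMETERS, never as opaque stubs);
the theorems are calibrations at print's setting (`…_zero_zero`, `…_uniform_…`, the forcing lemma), not evidence for any row; located ≠ adjudicated; typed ≠
proved; no side on [IUTchIII] Cor 3.12 / Rmk 3.9.3 / [IUTchIV] Thm 1.10 or on any author (D-0045); nothing here asserts that abc is proved or refuted.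
[claim: Mochizuki2012, status: disputed] for every IUT locution. [cite: Mochizuki2012, IUTchIII Prop. 3.9 (i) p. 116, Rmk. 3.9.3 p. 119–120, Cor. 3.12 p. 173–174;
IUTchIV Prop. 1.2 p. 10, Prop. 1.4 p. 13, Thm. 1.10 Step (v)–(x) p. 27–31; IUTchI Def. 3.1 p. 61–62, Prop. 4.9 p. 115, Def. 4.10 / Prop. 4.11 p. 119]
-/

noncomputable section
open Finset
namespace Summit.ABC.IUTFork.Repair.RH.Round4ConstraintRequirements
open Summit.ABC.IUTFork Summit.ABC.IUTFork.Thm311 Summit.ABC.IUTFork.Cor312 Literature.IUT.LogThetaLattice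

/-! ## §V3. Sheet V3 — LICENSING / the HONEST CONE (census O-12; rh3-gen-3 g7, `ROUND4/R4-7-V3-abc-iut-rh3-gen-3.md` 81bb2eeef91cce3d; referee rh-ref-1;
bed rh3-tst-1 `R4-7-BED-V3-rh3-tst-1.tsv`): «unlicensed cell worth −t + κ; d(c) ≤ t(c)». Item (b): B1 the cone relaxed by a fraction `x` with credit `κ` (THE
DOOR; the whole content of «drop V3» at `ω ≡ 1`) · B2 the container cap (integer, decidable per place) · B3 a licence beyond `margin ≥ 0` · B4 door (a)
non-isometric movers · B5 door (b) non-honest image content · B6 the LP under B1 · B0 delimitation (V1/V2/V4/V6 move kept mass among cells whose `ŝ` is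
fixed; only V3 and V5 change `ŝ`). -/

section V3Kernel

open Summit.ABC.IUTFork.Cor312.Setting Summit.ABC.IUTFork.Cor312Vol Summit.ABC.IUTFork.Repair.RH.SigmaLicence Summit.ABC.IUTFork.Repair.RH.SigmaMass

variable {T : ThetaIndex} {S : Situation T} (P : Cor312.Setting S)

/-- **B1 · THE DOOR — the cone relaxed by a fraction `x`, with credit `κ`** (sheet (b) B1 «`def ConeRelaxedBy (κ : Fin T.lstar × T.VQ → ℝ) (x : ℝ) : Prop := ∀ c,
c ∉ SigmaLicence.licenceCells P → SigmaLicence.cellDeficit P c.1 c.2 ≤ (1 - x) * SigmaMass.cellTrivialCost P c - κ c`. Status: `ConeRelaxedBy P 0 0` IS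
`cellDeficit_le_cellTrivialCost` (theorem under `BridgeHyps P`); `ConeRelaxedBy P (price·u) 0` is the sharp-setting identity p481438 read as ≤; every (κ, x) with
κ c + x·t(c) > price(c)·u at some unlicensed cell with t(c) > 0 CONTRADICTS p481438 … AT THE SHARP REAL SETTING OF RECORD (so it can only hold in a DIFFERENT
setting — B4/B5/B3′ say which). WHAT Θ-DATUM WOULD CERTIFY IT: a certified LOWER bound on the hull cell's volume exceeding the image's by x·t(c) + κ(c)»; B6: «at
μ₀ = 1 (ω ≡ 1) the whole content of “drop V3” is the single hypothesis B1 summed over the unlicensed cells»). THE requirement of row V3, in OUR currency; claim-tagged,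
not a Literature fact, licenses nothing by itself. [claim: Mochizuki2012, status: disputed] -/
@[claim "Mochizuki2012" "disputed"]
def V3_B1_coneRelaxedBy (κ : Fin T.lstar × T.VQ → ℝ) (x : ℝ) : Prop :=
  ∀ c : Fin T.lstar × T.VQ, c ∉ licenceCells P → cellDeficit P c.1 c.2 ≤ (1 - x) * cellTrivialCost P c - κ c

variable {P}

/-- CALIBRATION (sheet: «`ConeRelaxedBy P 0 0` IS `cellDeficit_le_cellTrivialCost`»): at `κ ≡ 0`, `x = 0` the relaxed cone is the landed honest cone, hence HOLDS
under the bridge hypotheses (p480491). [claim: Mochizuki2012, status: disputed] -/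
theorem V3_B1_coneRelaxedBy_zero_zero (H : BridgeHyps P) : V3_B1_coneRelaxedBy P (fun _ => 0) 0 := fun c _ => by
  rw [sub_zero, sub_zero, one_mul]
  exact cellDeficit_le_cellTrivialCost H c

variable (P)

/-- **B3 · A LICENCE BEYOND `margin ≥ 0`** (sheet (b) B3 «`def LicensedBeyond (c) : Prop := c ∈ SigmaLicence.licenceCells P` asserted at a cell whose exact margin is
negative — DECIDED FALSE in the sharp setting by the iff p460046 (licence ⟺ e_w·⌊(j²m_q − jδ_w − (j+1)R_in)/e_w⌋ ≤ m_q − (j+1)·R_out) … the indeterminacy that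
must shrink is (Ind3): print's one-sided (Ind3) certifies no cell-wise lower bound at all, so a licence is statable only under a TWO-SIDED (sharp) (Ind3) at
that cell … and the extra box volume it needs is charged one-for-one to the UPPER bound of Thm 1.10, a side the LP does not carry»): the cell `c` is licensed
(q-region inside the hull, `licenceCells`, p477034 lineage) although its certified integer margin of record `marginZ` (the R-W table / `D1WithinPlaceNet.margin`
at the cell's place data) is NEGATIVE. HYPOTHESIS; decided false in the sharp setting (by name above). [claim: Mochizuki2012, status: disputed] -/
@[claim "Mochizuki2012" "disputed"]
def V3_B3_licensedBeyond (c : Fin T.lstar × T.VQ) (marginZ : ℤ) : Prop :=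
  marginZ < 0 ∧ c ∈ licenceCells P

/-- **B5 · DOOR (b) — NON-HONEST IMAGE CONTENT** (sheet (b) B5 «`def RescaledContentAt (α : Fin T.lstar → ℝ) : Prop` (“the image at label j has content α_j·m_q
instead of j²·m_q”; `hscaled` of `CandJoshi1Barrier` dropped) — then demand becomes (α_j − 1)·m_q and at α_j ≤ 1 every cell is self-licensed with NO indeterminacy
volume used … Kernel status: `ObstructionSS8.not_S_of_stepX` / `supplier_false_of_stepX`, `CandJoshi1Barrier.not_joshiVolumeDominance_of_honestAt`,
`CandJoshi33.PF_forces_constant` p439789, `CandJoshi31.not_H''_varying` p432388 … B5 is where the j² of SS2018 lives: it changes the LP's INPUT column t, not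
V3»), over the setting's own log-volume: the (Ind3)-enlarged Θ-region at label `j = i+1` has log-volume `α_i ×` the q-pilot's (honest print content: `α_i =
(i+1)²`, q2-eq `imageGap_thetaRegion3_inr`). HYPOTHESIS on a hypothetical Θ-datum. [claim: Mochizuki2012, status: disputed] -/
@[claim "Mochizuki2012" "disputed"]
def V3_B5_rescaledContentAt (α : Fin T.lstar → ℝ) : Prop :=
  ∀ (i : Fin T.lstar) (vQ : T.VQ),
    (S.D P.n).logvol (labelSucc i) vQ (P.thetaRegion3 (labelSucc i) vQ) = α i * P.qLocal (labelSucc i) vQ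

end V3Kernel

section V3Movers

/-- **B4 · DOOR (a) — a NON-ISOMETRIC MOVER at a cell** (sheet (b) B4 «`def NonIsometricMoverAt (c) : Prop` (“some element of the (Ind1)/(Ind2) group acting at cell c
changes log-volume”; Step (x) `hvol` dropped at c). Kernel status AS TYPED on our partial/toy interfaces: isometric movers ⟹ ZERO gain
(`Joshi.….negLogTheta_eq_of_isometric` p498205; `not_cor312PerImageOf_of_hullEstimatePerImageOf_zero` p500550); a mover with valuation ≠ 0 ⟹ hull = EVERYTHING
(`thetaHull_eq_univ_of_val_ne_zero`); a non-Haar BOUNDED-volume-change (Ind2) exists as a typed object only on the FLIP-SHELLS MODEL bed (RC-166 … KILLED as a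
repair) … So B4 has NO typed instance giving a finite x ∈ (0, 1) at an honest genuine cell»), generic shape: among the moves `moves` acting on the ambient
space of the cell, SOME move changes the log-volume of the region `U`. HYPOTHESIS-shape in OUR currency (the (Ind1)/(Ind2) actions and `hvol` of [IUTchIII]
Cor 3.12 Step (x) are the instances named above). [claim: Mochizuki2012, status: disputed] -/
@[claim "Mochizuki2012" "disputed"]
def V3_B4_nonIsometricMoverAt {X : Type*} (moves : Set (X → X)) (logvol : Set X → ℝ) (U : Set X) : Prop :=
  ∃ g ∈ moves, logvol (g '' U) ≠ logvol U

end V3Movers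

section V3Table

open Summit.ABC.IUTFork.Repair.RH.HeightScaling Summit.ABC.IUTFork.Repair.RH.DiffPricedHull

/-- **B2 · THE CONSISTENCY SIDE — the CONTAINER CAP**, integer/rational form (sheet (b) B2 «`def ContainerConsistent (x : ℚ) (e m δ rin rout : ℤ) (L : ℕ) : Prop :=
∀ j : ℤ, 2 ≤ j → j ≤ L → ¬ RH.DiffPricedHull.HullCellδ e m j δ rin rout → x * (RH.HeightScaling.demand m j : ℚ) ≤ (RH.HeightScaling.price e m j δ rin rout : ℚ)`
(folklore-shaped bookkeeping; decidable per place). Reading: B1 with κ ≡ 0 stays inside print's container at place w iff `ContainerConsistent x …(w)`; the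
largest such uniform x is x_cap(w) = min_{j unlicensed} price_j/d_j, attained at j = l⋆ (`price_succ_mul_demand_le`); B1 with κ = price·u and any x > 0 violates
the cap at every unlicensed cell»), over the landed `HeightScaling.price`/`demand` (p532994) and `DiffPricedHull.HullCellδ` (p506542 lineage). Bookkeeping in OUR
currency. [folklore] -/
@[folklore]
def V3_B2_containerConsistent (x : ℚ) (e m δ rin rout : ℤ) (L : ℕ) : Prop :=
  ∀ j : ℤ, 2 ≤ j → j ≤ L → ¬ HullCellδ e m j δ rin rout → x * (demand m j : ℚ) ≤ (price e m j δ rin rout : ℚ)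

variable {ι 𝕜 : Type*} [Field 𝕜] [LinearOrder 𝕜] [IsStrictOrderedRing 𝕜]

/-- **B6 · THE LP UNDER B1 — the relaxed netting row** (sheet (b) B6 «`RelaxedNetting (κ) (x) (ω) : Prop := 0 ≤ Σ_c ω_c·ŝ_x(c)` with ŝ_x = s on σ, −t + κ + x·t
off σ; `ToptKnapsack.kept_le_dual` / `kept_eq_dual_iff` / `forcedLaw_of_optimal` are parametric in ŝ and apply verbatim; the door to S is unchanged in shape:
B1(κ, x) ∧ RelaxedNetting ⟹ weightedDeficit P ω ≤ 0 ⟹ `StatementUpTo P (Σ_c (1−ω_c)·t(c))` (p480491) — so B1 is LOAD-BEARING exactly through the netting row»),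
at the LP table of record (p488805's `s`, `t`, slacks): the netting row with the unlicensed cells' model slack raised from `−t + κ` to `−t + κ + x·t`. A row
of OUR LP. [claim: Mochizuki2012, status: disputed] -/
@[claim "Mochizuki2012" "disputed"]
def V3_B6_relaxedNetting [DecidableEq ι] (s σ : Finset ι) (t slack κ : ι → 𝕜) (x : 𝕜) (ω : ι → 𝕜) : Prop :=
  0 ≤ ∑ c ∈ s, ω c * (if c ∈ σ then slack c else -t c + κ c + x * t c)

omit [IsStrictOrderedRing 𝕜] in
/-- At `x = 0` the relaxed row is the LP's own netting row with `ŝ = slack` on `σ`, `−t + κ` off `σ` (the hypothesis `hnet` of `ToptKnapsack.kept_le_dual`). [folklore] -/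
theorem V3_B6_relaxedNetting_zero_iff [DecidableEq ι] (s σ : Finset ι) (t slack κ ω : ι → 𝕜) :
    V3_B6_relaxedNetting s σ t slack κ 0 ω ↔ 0 ≤ ∑ c ∈ s, ω c * (if c ∈ σ then slack c else -t c + κ c) := by
  unfold V3_B6_relaxedNetting
  simp only [MulZeroClass.zero_mul, add_zero]

end V3Table

/-! ## §V4. Sheet V4 — LABEL SYMMETRY / uniform label weights `1/l⋆` (census O-13; rh3-gen-4 g10, `ROUND4/R4-7-V4-abc-iut-rh3-gen-4.md`
a251bf4a1549629f; referee rh-ref-2; bed rh3-tst-2). Sheet §0: the LP (P) has NO V4 row — V4 lives in the COEFFICIENTS (`t(c) = (j²−1)·m_q(w)·u_w`,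
`u_w = ln p_w/(e_w·l⋆)`: the `1/l⋆` IS the uniform label weight) and in the DOOR/dictionary, both derived for `processionNormalized`
(`CellWeights.processionNormalized_eq_uniformWeights`); two readings never merged: (R1) SCHEME level (as-posed tier), (R2) MEASURE level (replace `1/l⋆` by
a label law `ν`). Item (b) objects B1 `LabelLaw`/`IsUniform` · B2 `LabelSymmetricUnder G` (THE GROUP IS THE PARAMETER) + the forcing lemma · B3 print's
sub-symmetry menu · B4 `CapsulePartition`/`Req_V4_M1` · B5 `Req_V4_M2` · B6 `LabelLawDoor`/the `ν`-Corollary (the sheet: «the load-bearing missing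
object of any V4-relaxation») · B7 downstream constant BY NAME. -/

section V4Laws

variable {n : ℕ}

/-- **B1 `LabelLaw`** (sheet (b) B1 «`structure LabelLaw (n : ℕ) where (ν : Fin n → ℝ) (nonneg : ∀ j, 0 ≤ ν j) (total : ∑ j, ν j = 1)` … The cell
currency under a law: `cellTrivialCost_ν w j := (n : ℝ) * ν.ν j * cellTrivialCost w j`, the same factor on the cell slack (sign, hence licence status,
unchanged)» (our object)): a probability vector on the `n = l⋆` labels `j = i+1`. OUR object (a hypothetical label measure replacing print's `1/l⋆`),
not an IUT object. [claim: Mochizuki2012, status: disputed] -/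
structure LabelLaw (n : ℕ) where
  /-- the weight of label `j = i + 1` -/
  ν : Fin n → ℝ
  /-- weights are non-negative -/
  nonneg : ∀ i, 0 ≤ ν i
  /-- total weight `1` -/
  total : ∑ i, ν i = 1

/-- **B1 `IsUniform`** (sheet «`def IsUniform (ν : LabelLaw n) : Prop := ∀ j, ν.ν j = 1 / n` (= V4; `processionNormalized` is the uniform law by
`processionNormalized_eq_uniformWeights`)»): the law IS print's `1/l⋆` — row V4 itself as a predicate on laws. [claim: Mochizuki2012, status: disputed] -/
@[claim "Mochizuki2012" "disputed"]
def LabelLaw.IsUniform (L : LabelLaw n) : Prop :=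
  ∀ i, L.ν i = 1 / (n : ℝ)

/-- Print's law: the uniform `LabelLaw` (`l⋆ ≥ 1`). [claim: Mochizuki2012, status: disputed] -/
def LabelLaw.uniform (hn : 0 < n) : LabelLaw n where
  ν := fun _ => 1 / (n : ℝ)
  nonneg := fun _ => by positivity
  total := by
    have : (n : ℝ) ≠ 0 := by exact_mod_cast hn.ne'
    rw [Finset.sum_const, Finset.card_univ, Fintype.card_fin, nsmul_eq_mul]
    field_simp

/-- `LabelLaw.uniform` is uniform. [folklore] -/
theorem LabelLaw.uniform_isUniform (hn : 0 < n) : (LabelLaw.uniform hn).IsUniform := fun _ => rfl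

/-- The `ν`-weighted label functional `Σ_i ν_i·vol_i` replacing print's procession normalisation `PN vol = Σ_i (1/l⋆)·vol_i` (sheet (R2) «replace 1/l⋆ by
a label law ν … inside t and ŝ alike»; the FENCE's free-weight functional `∑ j, c j * vol j`, `CellWeights.weightedSum_eq_processionNormalized_of_processionCompatible`).
HYPOTHETICAL bookkeeping. [claim: Mochizuki2012, status: disputed] -/
@[claim "Mochizuki2012" "disputed"]
def lawNormalized (L : LabelLaw n) (vol : Fin n → ℝ) : ℝ :=
  ∑ i, L.ν i * vol i

/-- CALIBRATION: at the uniform law the functional IS `processionNormalized` (`CellWeights.processionNormalized_eq_uniformWeights`, p488865). [folklore] -/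
theorem lawNormalized_uniform (hn : 0 < n) (vol : Fin n → ℝ) : lawNormalized (LabelLaw.uniform hn) vol = processionNormalized vol := by
  rw [CellWeights.processionNormalized_eq_uniformWeights]
  rfl

/-- **B2 `LabelSymmetricUnder G` — THE GROUP IS THE PARAMETER** (sheet (b) B2 «`def LabelSymmetricUnder (G : Type*) [Group G] [MulAction G (Fin n)]
(ν : LabelLaw n) : Prop := ∀ (g : G) (j : Fin n), ν.ν (g • j) = ν.ν j` … Print's two groups are pretransitive on their label sets (A2: `Prop49i`,
`flPM_isPretransitive`), so under EITHER printed group a symmetric law is V4. What relaxes V4 at this item is an action with r ≥ 2 orbits» (our object)):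
invariance of the law under a NAMED group acting on the labels. [claim: Mochizuki2012, status: disputed] -/
@[claim "Mochizuki2012" "disputed"]
def LabelLaw.SymmetricUnder (G : Type*) [Group G] [MulAction G (Fin n)] (L : LabelLaw n) : Prop :=
  ∀ (g : G) (i : Fin n), L.ν (g • i) = L.ν i

/-- **THE FORCING LEMMA** (sheet B2 «`theorem isUniform_of_pretransitive [MulAction.IsPretransitive G (Fin n)] (h : LabelSymmetricUnder G ν) : IsUniform ν`
(Mathlib one-liner; the typer's first theorem)»): a law symmetric under a PRETRANSITIVE label action is the uniform law — V4 is forced by any transitive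
symmetry (print: [IUTchIII] Rmk 3.9.3 «no choice but to assign the same weights», cf. `CellWeights.labelWeights_eq_uniform_of_processionCompatible`). [folklore] -/
theorem LabelLaw.isUniform_of_symmetricUnder (G : Type*) [Group G] [MulAction G (Fin n)] [MulAction.IsPretransitive G (Fin n)]
    (L : LabelLaw n) (h : L.SymmetricUnder G) : L.IsUniform := by
  intro i
  have hconst : ∀ i', L.ν i' = L.ν i := fun i' => by
    obtain ⟨g, hg⟩ := MulAction.exists_smul_eq G i i'
    rw [← hg, h g i]
  have hs : ∑ i', L.ν i' = (n : ℝ) * L.ν i := by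
    rw [Finset.sum_congr rfl fun i' _ => hconst i', Finset.sum_const, Finset.card_univ, Fintype.card_fin, nsmul_eq_mul]
  have htot := L.total
  rw [hs] at htot
  have hn : (n : ℝ) ≠ 0 := fun h0 => by rw [h0, zero_mul] at htot; exact zero_ne_one htot
  rw [eq_div_iff hn]
  linarith

/-- **B2 `HasOrbitCount`** (sheet «`def HasOrbitCount (G) [Group G] [MulAction G (Fin n)] (r : ℕ) : Prop := Nat.card (MulAction.orbitRel.Quotient G (Fin n)) =
r`; a `LabelSymmetricUnder G` law then has exactly r − 1 free parameters (constant on orbits)»), for any `G`-set `X` of labels: the action has exactly `r`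
orbits; `r ≥ 2` is what relaxes V4 at item B2. [folklore] -/
@[folklore]
def HasOrbitCount (G : Type*) [Group G] (X : Type*) [MulAction G X] (r : ℕ) : Prop :=
  Nat.card (MulAction.orbitRel.Quotient G X) = r

end V4Laws

section V4Menu

/-- **B3 — print's SUB-SYMMETRY MENU, clause (i)** (sheet (b) B3 «H ≤ 𝔽_l^⋇ (cyclic of order n = l⋆) acting on J by x ↦ |a·x| (|y| = min(y mod l, l − y mod l)):
orbits = cosets of H, r = n/|H| … for every L with 2 ≤ L ≤ n−1 the initial segment {1,…,L} is closed under the label product for NO L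
(`ReqsideLabelsNoSymmetry.truncatedLabels_closed_iff` …; `truncatedLabels_two_mul_escapes`), and the parity classes are not cosets
(`ReqsideLabelsParityNoSymmetry.oddLabels_not_mul_closed`, `evenLabels_not_coset`) — so NO proper H has a licence-initial segment as a union of orbits:
coset laws are multiplicatively scrambled against j ≤ j₀(w)»), in the faces' `ℕ`-currency: no initial segment `{1,…,L}`, `2 ≤ L < l⋆`, is stable under
multiplication by a label `a` with `|a| ≠ 1` (stability under the cyclic subgroup `⟨a⟩` ⟺ stability under `a`; a union of `⟨a⟩`-orbits IS an `a`-stable set).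
The sheet's ASSEMBLED CLAIM over the four landed faces (decided there for the product-closure and parity forms); stated, not proved here.
[claim: Mochizuki2012, status: disputed] -/
@[claim "Mochizuki2012" "disputed"]
def V4_B3_noStableInitialSegment (l : ℕ) : Prop :=
  ∀ a L : ℕ, 2 ≤ min (a % l) (l - a % l) → 2 ≤ L → L < (l - 1) / 2 →
    ∃ x : ℕ, 1 ≤ x ∧ x ≤ L ∧ L < min (a * x % l) (l - a * x % l)

/-- **B3, clause (ii)** (sheet «H ≤ 𝔽_l^{⋊±} = {x ↦ ±x + a} acting on T = 𝔽_l: every orbit has size 1, 2 or l (`ReqsideLabelsPlusMinusOrbits.affPM_no_midsize_orbit`: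
no H-orbit S with 3 ≤ |S| < l) — a subgroup containing a translation is transitive (r = 1 ⇒ V4 on T); a single reflection … leaves every J-label weight free
(r = n on J; no M2 constraint but also no comparison network)»; the sheet's menu signature «`PrintSubsymmetryMenu (l) : Prop := ∀ H ≤ (label symmetry of print),
HasOrbitCount H 1 ∨ (J-orbits are the cosets of a proper subgroup of 𝔽_l^⋇, none containing an initial segment …) ∨ (H acts trivially on J)`»): for every
family `H` of maps of `ZMod l` closed under composition and every `H`-stable label set `S`, `|S| ∈ {0, 1, 2}` or `S` is everything — the landed face
`affPM_no_midsize_orbit` (p529840) is the `𝔽_l^{⋊±}` instance; typed here as the MENU CLAUSE a V4-relaxing indexing must ESCAPE (an orbit of middle size).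
[claim: Mochizuki2012, status: disputed] -/
@[claim "Mochizuki2012" "disputed"]
def V4_B3_noMidsizeOrbit (l : ℕ) (H : Set (ZMod l → ZMod l)) : Prop :=
  ∀ S : Finset (ZMod l), (∀ f ∈ H, ∀ x ∈ S, f x ∈ S) → S.card ≤ 2 ∨ S.card = l

end V4Menu

section V4Objects

/-- **B4 `CapsulePartition`** (sheet (b) B4 «`structure CapsulePartition (X : Type*) [Fintype X] (r : ℕ) where (block : X → Fin r) (surj : Function.Surjective
block)` with capsule index sets A_i := block⁻¹{i} pairwise DISJOINT (so Rmk 3.9.3's hypothesis “j′ ≤ j₁, j₂ share the shell labelled j′” never fires across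
blocks and `Remark393_equalWeights` does not apply) and block weights `β : LabelLaw r` free» (our object)): a NON-NESTED capsule indexing of the label set `X`
into `r` disjoint blocks — the object that defeats mechanism M1 (the nested procession). OUR object, not an IUT object. [claim: Mochizuki2012, status: disputed] -/
structure CapsulePartition (X : Type*) (r : ℕ) where
  /-- the block of a label -/
  block : X → Fin r
  /-- every block is inhabited -/
  surj : Function.Surjective block

/-- **B4 `Req_V4_M1`** (sheet «`def Req_V4_M1 (n r : ℕ) : Prop := 2 ≤ r ∧ ∃ π : CapsulePartition (Fin n) r, TensorPacketVolumeTheoryOver π ∧ IndeterminacyCountLe π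
(Nat.factorial n)` — the two conjunct names are PLACEHOLDERS for statements print proves only for the nested chain ([IUTchIII] Prop 3.9 (i)–(iii), [IUTchI]
Prop 4.11); typed ≠ available»; what print gives up for it, located not adjudicated: processions and the `l⋇^{l⋇} → l⋇!` indeterminacy reduction [IUTchI]
Def 4.10 / Prop 4.11 (i), the zero label in every capsule [IUTchII] Rmk 2.6.3, the `(j+1)`-capsule packet bookkeeping [IUTchIII] Prop 3.4 (ii) / 3.5): the two
placeholder predicates are PARAMETERS here (CONVENTIONS §4: no opaque stubs) — a theory supplies its tensor-packet volume theory `VolTheory` and indeterminacy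
count `IndetLe` for non-nested partitions, and the requirement is their joint instance at some `π` with `r ≥ 2` blocks. [claim: Mochizuki2012, status: disputed] -/
@[claim "Mochizuki2012" "disputed"]
def V4_B4_reqM1 (n r : ℕ) (VolTheory : CapsulePartition (Fin n) r → Prop) (IndetLe : CapsulePartition (Fin n) r → ℕ → Prop) : Prop :=
  2 ≤ r ∧ ∃ π : CapsulePartition (Fin n) r, VolTheory π ∧ IndetLe π (Nat.factorial n)

/-- **B5 `Req_V4_M2` — labels indexed by a `G`-set with `r ≥ 2` orbits, each orbit still a torsor** (sheet (b) B5 «`def Req_V4_M2 (G : Type*) [Group G] (X : Type*)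
[MulAction G X] (r : ℕ) : Prop := HasOrbitCount G r ∧ 2 ≤ r ∧ (∀ O : MulAction.orbitRel.Quotient G X, IsTorsorOn G O) ∧ ComparisonNetworkWithin G X ∧
ConjugateSynchronisationOver G X` — … each orbit still a torsor (so [IUTchI] Rmk 4.9.1 (i)'s comparisons survive orbit by orbit), the last two conjuncts
PLACEHOLDERS for what print proves for the single torsor (A2). Smallest NAMED instances: (α) two-torsion-prime indexing G = 𝔽_{l₁}^⋇ × 𝔽_{l₂}^⋇ … (β) coset
indexing G = H < 𝔽_l^⋇ proper … (γ) trivial group» (our object; KEY: «which symmetry group a construction could have»)): «each orbit a torsor» is typed as a FREE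
action (trivial stabilisers — an orbit of a free action is a torsor); the comparison network and conjugate synchronisation are PARAMETERS (placeholders in the
sheet; CONVENTIONS §4). THE GROUP `G` IS THE PARAMETER. [claim: Mochizuki2012, status: disputed] -/
@[claim "Mochizuki2012" "disputed"]
def V4_B5_reqM2 (G : Type*) [Group G] (X : Type*) [MulAction G X] (r : ℕ) (ComparisonNetworkWithin ConjugateSynchronisationOver : Prop) : Prop :=
  HasOrbitCount G X r ∧ 2 ≤ r ∧ (∀ x : X, MulAction.stabilizer G x = ⊥) ∧ ComparisonNetworkWithin ∧ ConjugateSynchronisationOver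

end V4Objects

section V4Door

variable {T : ThetaIndex} {S : Situation T} (P : Cor312.Setting S)

open scoped Classical in
/-- **B6 — the `ν`-NORMALISED `−|log(Θ)|`** (towards the sheet's `StatementUpTo_ν`; pattern of abc-iut-reqb-typ-1's K2 `negLogThetaUpTo`, p536101, with the
truncation `1_{j ≤ L}/L` replaced by a general law `ν` on the `l⋆` labels): the `ν`-weighted global log-volume of the hull of the possible images, `⊤` unless
print's `ThetaFinite`. HYPOTHETICAL (no printed object for `ν ≠ 1/l⋆`). [claim: Mochizuki2012, status: disputed] -/
@[claim "Mochizuki2012" "disputed"]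
def negLogThetaLaw (L : LabelLaw T.lstar) : WithTop ℝ :=
  if P.ThetaFinite then
    ((lawNormalized L fun i : Fin T.lstar => ∑ᶠ vQ : T.VQ, (P.thetaLocal (Cor312.Setting.labelSucc i) vQ).untopD 0 : ℝ) : WithTop ℝ)
  else ⊤

/-- **B6 — the `ν`-NORMALISED `−|log(q)|`**: the `ν`-weighted global log-volume of the q-pilot image. HYPOTHETICAL. [claim: Mochizuki2012, status: disputed] -/
@[claim "Mochizuki2012" "disputed"]
def negLogQLaw (L : LabelLaw T.lstar) : ℝ :=
  lawNormalized L fun i : Fin T.lstar => ∑ᶠ vQ : T.VQ, P.qLocal (Cor312.Setting.labelSucc i) vQ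

/-- **B6 `StatementUpTo_ν` — THE `ν`-COROLLARY UP TO `ε`** (sheet (b) B6 «the ν-analogue of the weighted door p480491 and of `statement_iff_signedRemainder_nonpos`:
`def LabelLawDoor (ν : LabelLaw n) : Prop := ∀ ω, weightedDeficit_ν ω ≤ 0 → StatementUpTo_ν P (weightedTrivialMass_ν ω)` … Status: NOT TYPED — rh-lead ACKS-1 (iii)
02:39:42Z “a derivation that changes the label NORMALISATION itself has NO typed door today” … This is the load-bearing missing object of any V4-relaxation»):
«`−|log(Θ)|_ν ∈ ℝ` and `−|log(q)|_ν ≤ −|log(Θ)|_ν + ε`» — what a `ν`-indexed construction must make a THEOREM in place of [IUTchIII] Cor 3.12 (at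
`ν = 1/l⋆`, `ε = 0` it IS the printed `Statement`: `lawStatementUpTo_uniform_zero_iff`). HYPOTHETICAL reading over our typed setting; claim-tagged
requirement, not a Literature fact, licenses nothing by itself. [claim: Mochizuki2012, status: disputed] -/
@[claim "Mochizuki2012" "disputed"]
def LawStatementUpTo (L : LabelLaw T.lstar) (ε : ℝ) : Prop :=
  negLogThetaLaw P L ≠ ⊤ ∧ ((negLogQLaw P L : ℝ) : WithTop ℝ) ≤ negLogThetaLaw P L + ((ε : ℝ) : WithTop ℝ)

/-- CALIBRATION: at print's uniform law and `ε = 0` the `ν`-Corollary IS [IUTchIII] Cor 3.12 as typed (`Cor312.Setting.Statement`, abc-iut-c312-7). [folklore] -/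
theorem lawStatementUpTo_uniform_zero_iff (hn : 0 < T.lstar) : LawStatementUpTo P (LabelLaw.uniform hn) 0 ↔ P.Statement := by
  unfold LawStatementUpTo negLogThetaLaw negLogQLaw Cor312.Setting.Statement Cor312.Setting.negLogTheta Cor312.Setting.negLogQ
  simp only [lawNormalized_uniform, WithTop.coe_zero, add_zero]

/-- **B6 `LabelLawDoor ν`** (sheet's signature, verbatim intent): for every cell weight `ω ≤ 1`, «`ν`-weighted netted deficit `≤ 0` ⟹ the `ν`-Corollary up to the
`ν`-weighted conceded trivial mass» — the `ν`-analogue of THE WEIGHTED DOOR `statementUpTo_weightedTrivialMass_of_weightedDeficit_nonpos` (p480491), with the cell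
deficit `d` and trivial cost `t` supplied by the theory as functions on cells (parameters: at `ν = 1/l⋆` take `d := cellDeficit P`, `t := cellTrivialCost P` of
p479556/p477034). Requirement in OUR currency; NOT a theorem of the tree for `ν ≠ 1/l⋆` (the sheet: «the load-bearing missing object»); nothing here asserts it.
[claim: Mochizuki2012, status: disputed] -/
@[claim "Mochizuki2012" "disputed"]
def V4_B6_labelLawDoor (L : LabelLaw T.lstar) (d t : Fin T.lstar × T.VQ → ℝ) : Prop :=
  ∀ ω : Fin T.lstar × T.VQ → ℝ, (∀ c, ω c ≤ 1) →
    lawNormalized L (fun i => ∑ᶠ vQ : T.VQ, ω (i, vQ) * d (i, vQ)) ≤ 0 →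
      LawStatementUpTo P L (lawNormalized L fun i => ∑ᶠ vQ : T.VQ, (1 - ω (i, vQ)) * t (i, vQ))

end V4Door

section V4Constant

variable {n : ℕ}

/-- **B6/B7 — the `ν`-DICTIONARY CONSTANT `C(ν, l) = 2l·E_ν[j+1]/(E_ν[j²] − 1)`** (sheet B6 «`LabelLawDisplay (ν)` := “((E_ν[j²]−1)/2l)·μ·log q ≤ E_ν[j+1]·A + B”
(FENCE «THE SHAPE BEING PARAMETRISED»; constant C(ν,l) = 2l·E_ν[j+1]/(E_ν[j²]−1))»; B7 «what any ν does to the Thm-1.10-type constant … `weightedSqSubOne_le`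
(every ν: C(ν,l) ≥ 2l/(n−1) = 4l/(l−3)), `weightedSqSubOne_eq_iff` (equality ⟺ ν sits on the TOP label), `uniformConstant_eq` (C(unif) = 6l(l+5)/((l−3)(l+4))
> 6), `topConstant_eq` …»): the height-inequality constant a law `ν` would put in front of the error terms of [IUTchIV] Thm 1.10 Step (v)/(viii) (labels
`j = i+1`; `E_ν[j²] − 1 = Σ ν_i((i+1)²−1)` since `Σ ν = 1`). Bookkeeping in OUR currency (FENCE p488865 is the arithmetic). [claim: Mochizuki2012, status: disputed] -/
@[claim "Mochizuki2012" "disputed"]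
def lawConstant (l : ℕ) (L : LabelLaw n) : ℝ :=
  2 * (l : ℝ) * (∑ i : Fin n, L.ν i * ((((i : ℕ) : ℝ) + 1) + 1)) / ∑ i : Fin n, L.ν i * ((((i : ℕ) : ℝ) + 1) ^ 2 - 1)

/-- **B7 BY NAME**: for every law the gap side is dominated by the top label, `Σ ν_i((i+1)²−1) ≤ (n−1)·Σ ν_i(i+2)` (FENCE `CellWeights.weightedSqSubOne_le`,
p488865) — i.e. `C(ν,l) ≥ 2l/(n−1)` whenever the gap side is positive; equality iff `ν` sits on the top label (`weightedSqSubOne_eq_iff`). [folklore] -/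
theorem lawConstant_gapSide_le (L : LabelLaw n) :
    ∑ i : Fin n, L.ν i * ((((i : ℕ) : ℝ) + 1) ^ 2 - 1) ≤ ((n : ℝ) - 1) * ∑ i : Fin n, L.ν i * ((((i : ℕ) : ℝ) + 1) + 1) :=
  CellWeights.weightedSqSubOne_le L.ν L.nonneg

end V4Constant

end Summit.ABC.IUTFork.Repair.RH.Round4ConstraintRequirements

end
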